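import Mathlib
import Literature.Combinatorics.Enumerative.MotzkinPathOfInvolution
import Literature.Combinatorics.Enumerative.InvolutionsAvoiding4321And132
import HarnessLib

/-!
# Centrosymmetric restricted involutions and symmetric Motzkin paths: `|CI_n(3412)| = |CI_n(4321)| = #{symmetric Motzkin words}` (Barnabei–Bonetti–Silimbani 2011, §7, Theorem 13)

Layer `Literature/Combinatorics/Enumerative`, namespace `Literature.Combinatorics.Enumerative.PermContainsPattern`; lane
`lit-hodgefound` (prover seat p13, generation 39, theme «nonnesting / noncrossing matchings and restricted
involutions»).  Sequel of `MotzkinPathOfInvolution.lean` (`u ↦ motzkinPath u` is a bijection `I_n(3412) → 𝓜_n` and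
`I_n(4321) → 𝓜_n`).

## Source

M. Barnabei, F. Bonetti, M. Silimbani, *Restricted involutions and Motzkin paths*, Adv. Appl. Math. **47** (2011)
102–115 = arXiv:0812.0463 [BarnabeiBonettiSilimbani2011] (held text `paper-arxiv-0812.0463`, arXiv numbering, §7):

> A centrosymmetric involution is an element `τ ∈ I_n` such that `τ_{rc} = τ` … Theorem 1 implies that the Motzkin
> path associated with a centrosymmetric involution `τ ∈ CI_n` must be symmetric with respect to the vertical line
> `x = n/2`. The converse is false, in general. … However, if a symmetric Motzkin path `M` is endowed with either the
> maximal or the unitary labelling, then the corresponding involution is centrosymmetric. In fact, … suppose that there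
> exists a symmetric Motzkin path `M` such that the corresponding involution `τ ∈ I_n(4321)` is not centrosymmetric,
> namely, `τ_{rc} ≠ τ`. Then, also `τ_{rc}` avoids `4321` … This implies that `τ_{rc}` corresponds to the same
> Motzkin path with the same labelling, hence contradicting Theorem 2. The case of the maximal labelling can be
> treated similarly … The bijection between [symmetric] Motzkin paths and centrosymmetric involutions avoiding `4321`
> (or `3412`) yields … **Theorem 13.** `|CI_{2h+1}(4321)| = |CI_{2h+1}(3412)| = |CI_{2h}(4321)| = |CI_{2h}(3412)| = Σ_i …`.

## Formalisation (arc language; theorems only)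

The reverse-complement of `u` is `rev * u * rev` (as in `RestrictedInvolutionsMotzkin.lean`); `u` is centrosymmetric iff
`∀ i, u (rev i) = rev (u i)`.  A word `w : Fin n → Fin 3` is *symmetric* when `w (rev i) = ![0, 2, 1] (w i)` (the mirror
image of a Motzkin path exchanges up and down steps).
* §1 `motzkinPath_reverseComplement` (THEOREM 1, unlabelled: the path of `u_{rc}` is the mirror image),
  `motzkinPath_symmetric_of_centrosymmetric`.
* §2 ★★ `centrosymmetric_iff_motzkinPath_symmetric_of_av3412` / `_of_av4321`: for `u ∈ I_n(3412)` (resp. `I_n(4321)`),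
  `u` is centrosymmetric iff its path is symmetric (the printed argument: `u_{rc}` has the same path, Theorem 7 / 2).
* §3 ★★★ `card_centrosymmetric_av3412_eq_card_symmetric_motzkinWords`, `card_centrosymmetric_av4321_eq_…` and
  `card_centrosymmetric_av4321_eq_av3412` (`|CI_n(4321)| = |CI_n(3412)|`, the pattern part of THEOREM 13; the closed
  formula by Motzkin prefixes and `|CI_{2h+1}| = |CI_{2h}|` are not here).
-/

namespace Literature.Combinatorics.Enumerative

namespace PermContainsPattern

open Finset Equiv

variable {n : ℕ}

/-! ### §1 The path of the reverse-complement -/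

/-- **THEOREM 1 (unlabelled part): the Motzkin path of `u_{rc}` is the mirror image of the path of `u`** (up and down
steps exchanged and the order reversed). [cite: BarnabeiBonettiSilimbani2011, Theorem 1 (arXiv 0812.0463)] -/
theorem motzkinPath_reverseComplement (u : Perm (Fin n)) (i : Fin n) :
    motzkinPath (Fin.revPerm * u * Fin.revPerm) i = ![0, 2, 1] (motzkinPath u (Fin.rev i)) := by
  have e : ∀ x, (Fin.revPerm * u * Fin.revPerm : Perm (Fin n)) x = Fin.rev (u (Fin.rev x)) := fun x => rfl
  unfold motzkinPath
  simp only [e, Fin.lt_def, Fin.val_rev]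
  have h1 := (u (Fin.rev i)).2
  have h2 := i.2
  split_ifs <;> first | rfl | (exfalso; omega)

/-- `u` is centrosymmetric (`u_{rc} = u`) iff `∀ i, u (rev i) = rev (u i)`. [cite: BarnabeiBonettiSilimbani2011, §7 («`τ(i) + τ(n+1−i) = n+1`»; arXiv 0812.0463)] -/
theorem reverseComplement_eq_self_iff (u : Perm (Fin n)) :
    Fin.revPerm * u * Fin.revPerm = u ↔ ∀ i, u (Fin.rev i) = Fin.rev (u i) := by
  constructor
  · intro h i
    have := Equiv.ext_iff.1 h (Fin.rev i)
    change Fin.rev (u (Fin.rev (Fin.rev i))) = u (Fin.rev i) at this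
    rw [Fin.rev_rev] at this
    exact this.symm
  · intro h
    refine Equiv.ext fun i => ?_
    change Fin.rev (u (Fin.rev i)) = u i
    rw [h, Fin.rev_rev]

/-- The path of a centrosymmetric involution is symmetric. [cite: BarnabeiBonettiSilimbani2011, §7 («the Motzkin path associated with a centrosymmetric involution … must be symmetric»; arXiv 0812.0463)] -/
theorem motzkinPath_symmetric_of_centrosymmetric {u : Perm (Fin n)} (h : ∀ i, u (Fin.rev i) = Fin.rev (u i)) (i : Fin n) :
    motzkinPath u (Fin.rev i) = ![0, 2, 1] (motzkinPath u i) := by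
  have := motzkinPath_reverseComplement u (Fin.rev i)
  rwa [(reverseComplement_eq_self_iff u).2 h, Fin.rev_rev] at this

/-! ### §2 For `3412`- or `4321`-avoiding involutions the converse holds -/

/-- ★★ For `u ∈ I_n(3412)`: `u` is centrosymmetric iff its Motzkin path is symmetric («if a symmetric Motzkin path is
endowed with the maximal labelling, then the corresponding involution is centrosymmetric»: `u_{rc} ∈ I_n(3412)` has the
same path, so `u_{rc} = u` by Theorem 7). [cite: BarnabeiBonettiSilimbani2011, §7 (paragraph before Theorem 13) (arXiv 0812.0463)] -/
theorem centrosymmetric_iff_motzkinPath_symmetric_of_av3412 {u : Perm (Fin n)} (hu : u * u = 1)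
    (h3412 : ¬ PermContainsPattern u ![3, 4, 1, 2]) :
    (∀ i, u (Fin.rev i) = Fin.rev (u i)) ↔ ∀ i, motzkinPath u (Fin.rev i) = ![0, 2, 1] (motzkinPath u i) := by
  refine ⟨fun h => motzkinPath_symmetric_of_centrosymmetric h, fun h => ?_⟩
  rw [← reverseComplement_eq_self_iff]
  have hu' : ∀ x, u (u x) = x := (mul_self_eq_one_iff_apply_apply u).1 hu
  have hrcinv : (Fin.revPerm * u * Fin.revPerm) * (Fin.revPerm * u * Fin.revPerm) = 1 :=
    (reverseComplement_mul_self_eq_one_iff u).2 hu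
  have hrc' : ∀ x, (Fin.revPerm * u * Fin.revPerm : Perm (Fin n)) ((Fin.revPerm * u * Fin.revPerm : Perm (Fin n)) x) = x :=
    (mul_self_eq_one_iff_apply_apply _).1 hrcinv
  have hrc3412 : ¬ PermContainsPattern (Fin.revPerm * u * Fin.revPerm) ![3, 4, 1, 2] :=
    fun hc => h3412 ((reverseComplement_contains_3412_iff u).1 hc)
  refine eq_of_motzkinPath_eq_of_noncrossing hrc' hu' ((not_contains_3412_iff_noncrossing hrc').1 hrc3412)
    ((not_contains_3412_iff_noncrossing hu').1 h3412) (funext fun i => ?_)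
  rw [motzkinPath_reverseComplement, h i]
  have : ∀ s : Fin 3, (![0, 2, 1] : Fin 3 → Fin 3) ((![0, 2, 1] : Fin 3 → Fin 3) s) = s := by decide
  exact this _

/-- ★★ For `u ∈ I_n(4321)`: `u` is centrosymmetric iff its Motzkin path is symmetric (unitary labelling; Theorem 2).
[cite: BarnabeiBonettiSilimbani2011, §7 (paragraph before Theorem 13) (arXiv 0812.0463)] -/
theorem centrosymmetric_iff_motzkinPath_symmetric_of_av4321 {u : Perm (Fin n)} (hu : u * u = 1)
    (h4321 : ¬ PermContainsPattern u ![4, 3, 2, 1]) :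
    (∀ i, u (Fin.rev i) = Fin.rev (u i)) ↔ ∀ i, motzkinPath u (Fin.rev i) = ![0, 2, 1] (motzkinPath u i) := by
  refine ⟨fun h => motzkinPath_symmetric_of_centrosymmetric h, fun h => ?_⟩
  rw [← reverseComplement_eq_self_iff]
  have hu' : ∀ x, u (u x) = x := (mul_self_eq_one_iff_apply_apply u).1 hu
  have hrcinv : (Fin.revPerm * u * Fin.revPerm) * (Fin.revPerm * u * Fin.revPerm) = 1 :=
    (reverseComplement_mul_self_eq_one_iff u).2 hu
  have hrc' : ∀ x, (Fin.revPerm * u * Fin.revPerm : Perm (Fin n)) ((Fin.revPerm * u * Fin.revPerm : Perm (Fin n)) x) = x :=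
    (mul_self_eq_one_iff_apply_apply _).1 hrcinv
  have hrc4321 : ¬ PermContainsPattern (Fin.revPerm * u * Fin.revPerm) ![4, 3, 2, 1] :=
    fun hc => h4321 ((reverseComplement_contains_4321_iff u).1 hc)
  refine eq_of_motzkinPath_eq_of_nonnesting hrc' hu' ((not_contains_4321_iff_nonnesting hrc').1 hrc4321)
    ((not_contains_4321_iff_nonnesting hu').1 h4321) (funext fun i => ?_)
  rw [motzkinPath_reverseComplement, h i]
  have : ∀ s : Fin 3, (![0, 2, 1] : Fin 3 → Fin 3) ((![0, 2, 1] : Fin 3 → Fin 3) s) = s := by decide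
  exact this _

/-! ### §3 `|CI_n(3412)| = |CI_n(4321)| = #{symmetric Motzkin words}` -/

/-- ★★★ **THEOREM 13 (pattern part), `3412`: the centrosymmetric `3412`-avoiding involutions of `[n]` are equinumerous
with the symmetric Motzkin words of length `n`** (restriction of the bijection `motzkinPath`).
[cite: BarnabeiBonettiSilimbani2011, §7 and Theorem 13 (arXiv 0812.0463)] -/
theorem card_centrosymmetric_av3412_eq_card_symmetric_motzkinWords (n : ℕ) :
    Nat.card {u : Perm (Fin n) // (u * u = 1 ∧ ¬ PermContainsPattern u ![3, 4, 1, 2]) ∧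
        ∀ i, u (Fin.rev i) = Fin.rev (u i)} =
      ((motzkinWords n).filter fun w => ∀ i, w (Fin.rev i) = ![0, 2, 1] (w i)).card := by
  rw [← Nat.card_eq_finsetCard]
  refine Nat.card_congr (Equiv.ofBijective (fun u => ⟨motzkinPath u.1, mem_filter.2
    ⟨motzkinPath_mem_motzkinWords ((mul_self_eq_one_iff_apply_apply u.1).1 u.2.1.1),
      motzkinPath_symmetric_of_centrosymmetric u.2.2⟩⟩) ⟨?_, ?_⟩)
  · intro u v huv
    have := (motzkinPath_bijective_av3412 n).1 (a₁ := ⟨u.1, u.2.1⟩) (a₂ := ⟨v.1, v.2.1⟩)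
      (Subtype.ext (congrArg Subtype.val huv :))
    have h1 := congrArg Subtype.val this
    exact Subtype.ext h1
  · rintro ⟨w, hw⟩
    obtain ⟨hwm, hws⟩ := mem_filter.1 hw
    obtain ⟨⟨u, hu⟩, huw⟩ := (motzkinPath_bijective_av3412 n).2 ⟨w, hwm⟩
    have huw' : motzkinPath u = w := congrArg Subtype.val huw
    refine ⟨⟨u, hu, (centrosymmetric_iff_motzkinPath_symmetric_of_av3412 hu.1 hu.2).2 fun i => ?_⟩,
      Subtype.ext huw'⟩
    rw [huw']
    exact hws i

/-- ★★★ **THEOREM 13 (pattern part), `4321`: the centrosymmetric `4321`-avoiding involutions of `[n]` are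
equinumerous with the symmetric Motzkin words of length `n`.** [cite: BarnabeiBonettiSilimbani2011, §7 and Theorem 13 (arXiv 0812.0463)] -/
theorem card_centrosymmetric_av4321_eq_card_symmetric_motzkinWords (n : ℕ) :
    Nat.card {u : Perm (Fin n) // (u * u = 1 ∧ ¬ PermContainsPattern u ![4, 3, 2, 1]) ∧
        ∀ i, u (Fin.rev i) = Fin.rev (u i)} =
      ((motzkinWords n).filter fun w => ∀ i, w (Fin.rev i) = ![0, 2, 1] (w i)).card := by
  rw [← Nat.card_eq_finsetCard]
  refine Nat.card_congr (Equiv.ofBijective (fun u => ⟨motzkinPath u.1, mem_filter.2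
    ⟨motzkinPath_mem_motzkinWords ((mul_self_eq_one_iff_apply_apply u.1).1 u.2.1.1),
      motzkinPath_symmetric_of_centrosymmetric u.2.2⟩⟩) ⟨?_, ?_⟩)
  · intro u v huv
    have := (motzkinPath_bijective_av4321 n).1 (a₁ := ⟨u.1, u.2.1⟩) (a₂ := ⟨v.1, v.2.1⟩)
      (Subtype.ext (congrArg Subtype.val huv :))
    have h1 := congrArg Subtype.val this
    exact Subtype.ext h1
  · rintro ⟨w, hw⟩
    obtain ⟨hwm, hws⟩ := mem_filter.1 hw
    obtain ⟨⟨u, hu⟩, huw⟩ := (motzkinPath_bijective_av4321 n).2 ⟨w, hwm⟩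
    have huw' : motzkinPath u = w := congrArg Subtype.val huw
    refine ⟨⟨u, hu, (centrosymmetric_iff_motzkinPath_symmetric_of_av4321 hu.1 hu.2).2 fun i => ?_⟩,
      Subtype.ext huw'⟩
    rw [huw']
    exact hws i

/-- ★★★ **THEOREM 13 (pattern part): `|CI_n(4321)| = |CI_n(3412)|`.** [cite: BarnabeiBonettiSilimbani2011, Theorem 13 (arXiv 0812.0463)] -/
theorem card_centrosymmetric_av4321_eq_av3412 (n : ℕ) :
    Nat.card {u : Perm (Fin n) // (u * u = 1 ∧ ¬ PermContainsPattern u ![4, 3, 2, 1]) ∧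
        ∀ i, u (Fin.rev i) = Fin.rev (u i)} =
      Nat.card {u : Perm (Fin n) // (u * u = 1 ∧ ¬ PermContainsPattern u ![3, 4, 1, 2]) ∧
        ∀ i, u (Fin.rev i) = Fin.rev (u i)} := by
  rw [card_centrosymmetric_av4321_eq_card_symmetric_motzkinWords,
    card_centrosymmetric_av3412_eq_card_symmetric_motzkinWords]

end PermContainsPattern

end Literature.Combinatorics.Enumerative
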